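import Summits.HubbardSuperconductivity.HubbardSuperconductivity.Theorems.AnisotropyChordTransferFibre3FamilyALemmas

/-!
# Route `AnisotropyChord` / H0 rotor rung: PartN38 — the one-sided trapezoidal bound `TrapezoidConvex` PROVED

Typed target `TrapezoidConvex` of `…Fibre3FamilyALemmas` (PORT PartN38, theory seat `hubbard-h0-rotor-theory-1` g21, memo 21
§316): for `f` convex on `[A, B]` (`A < B` integers) with a derivative `f'` there,
`0 ≤ Σ_{m=A}^{B} f(m) − ∫_A^B f − (f(A)+f(B))/2 ≤ (f'(B) − f'(A))/8`.
Proof (no Euler–Maclaurin kernel needed): per unit interval `[a, a+1]`, the chord lies above `f` (convexity) and the two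
tangent lines at `a` (on `[a, a+½]`) and at `a+1` (on `[a+½, a+1]`) lie below `f` (`ConvexOn.le_slope_of_hasDerivAt`,
`ConvexOn.slope_le_of_hasDerivAt`); integrating gives `0 ≤ (f(a)+f(a+1))/2 − ∫_a^{a+1} f ≤ (f'(a+1) − f'(a))/8`;
then sum over the unit intervals (`intervalIntegral.sum_integral_adjacent_intervals`) and telescope.  The continuity
hypothesis on `f'` is not used.
Prover seat `hubbard-h0-rotor-p1` g23; helper for stmt-HubbardSuperconductivity-19089 (`--supports`).
-/

set_option linter.dupNamespace false
set_option autoImplicit false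

noncomputable section

open scoped BigOperators
open MeasureTheory

namespace Summit.HubbardSuperconductivity.HubbardSuperconductivity.Theorems.AnisotropyChord.Transfer.Fibre3

/-- `∫_a^b (p + q(x − c)) dx = p(b − a) + q((b−c)² − (a−c)²)/2`. [folklore] -/
theorem integral_affine (p q c a b : ℝ) :
    ∫ x in a..b, (p + q * (x - c)) = p * (b - a) + q * ((b - c) ^ 2 - (a - c) ^ 2) / 2 := by
  have h1 : IntervalIntegrable (fun _ : ℝ => p) volume a b := intervalIntegrable_const
  have h2 : IntervalIntegrable (fun x : ℝ => q * (x - c)) volume a b := by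
    apply Continuous.intervalIntegrable; fun_prop
  rw [intervalIntegral.integral_add h1 h2, intervalIntegral.integral_const, intervalIntegral.integral_const_mul,
    intervalIntegral.integral_sub intervalIntegral.intervalIntegrable_id intervalIntegrable_const,
    integral_id, intervalIntegral.integral_const]
  simp only [smul_eq_mul]
  ring

/-- **the unit-interval trapezoid error of a convex differentiable function:**
`0 ≤ (f(a)+f(a+1))/2 − ∫_a^{a+1} f ≤ (f'(a+1) − f'(a))/8`. [folklore] -/
theorem trapezoid_unit {f f' : ℝ → ℝ} {S : Set ℝ} (hfc : ConvexOn ℝ S f) {a : ℝ} (hsub : Set.Icc a (a + 1) ⊆ S)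
    (hd : ∀ x ∈ Set.Icc a (a + 1), HasDerivAt f (f' x) x) :
    0 ≤ (f a + f (a + 1)) / 2 - ∫ x in a..(a + 1), f x ∧
      (f a + f (a + 1)) / 2 - ∫ x in a..(a + 1), f x ≤ (f' (a + 1) - f' a) / 8 := by
  have ha : a ∈ S := hsub ⟨le_rfl, by linarith⟩
  have hb : a + 1 ∈ S := hsub ⟨by linarith, le_rfl⟩
  have hcont : ContinuousOn f (Set.Icc a (a + 1)) := fun x hx => (hd x hx).continuousAt.continuousWithinAt
  have hint : ∀ u v : ℝ, a ≤ u → u ≤ v → v ≤ a + 1 → IntervalIntegrable f volume u v := by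
    intro u v hu huv hv
    refine ContinuousOn.intervalIntegrable ?_
    rw [Set.uIcc_of_le huv]
    exact hcont.mono (Set.Icc_subset_Icc hu hv)
  constructor
  · -- chord above the graph
    have hch : ∀ x ∈ Set.Icc a (a + 1), f x ≤ f a + (f (a + 1) - f a) * (x - a) := by
      intro x hx
      have h := hfc.2 ha hb (show 0 ≤ a + 1 - x by linarith [hx.2]) (show 0 ≤ x - a by linarith [hx.1]) (by ring)
      simp only [smul_eq_mul] at h
      have e : (a + 1 - x) * a + (x - a) * (a + 1) = x := by ring
      rw [e] at h
      linarith
    have hI := intervalIntegral.integral_mono_on (by linarith) (hint a (a + 1) le_rfl (by linarith) le_rfl)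
      (by apply Continuous.intervalIntegrable; fun_prop) hch
    rw [integral_affine] at hI
    linarith
  · -- tangent lines below the graph, on the two halves
    have hc : a ≤ a + 1 / 2 := by linarith
    have ht1 : ∀ x ∈ Set.Icc a (a + 1 / 2), f a + f' a * (x - a) ≤ f x := by
      intro x hx
      rcases eq_or_lt_of_le hx.1 with h | h
      · rw [← h]; simp
      · have hxS : x ∈ S := hsub ⟨hx.1, by linarith [hx.2]⟩
        have hs := hfc.le_slope_of_hasDerivAt ha hxS h (hd a ⟨le_rfl, by linarith⟩)
        rw [slope_def_field, le_div_iff₀ (by linarith)] at hs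
        linarith
    have ht2 : ∀ x ∈ Set.Icc (a + 1 / 2) (a + 1), f (a + 1) + f' (a + 1) * (x - (a + 1)) ≤ f x := by
      intro x hx
      rcases eq_or_lt_of_le hx.2 with h | h
      · rw [h]; simp
      · have hxS : x ∈ S := hsub ⟨by linarith [hx.1], hx.2⟩
        have hs := hfc.slope_le_of_hasDerivAt hxS hb h (hd (a + 1) ⟨by linarith, le_rfl⟩)
        rw [slope_def_field, div_le_iff₀ (by linarith)] at hs
        linarith
    have hI1 := intervalIntegral.integral_mono_on hc (by apply Continuous.intervalIntegrable; fun_prop)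
      (hint a (a + 1 / 2) le_rfl hc (by linarith)) ht1
    have hI2 := intervalIntegral.integral_mono_on (by linarith : a + 1 / 2 ≤ a + 1)
      (by apply Continuous.intervalIntegrable; fun_prop) (hint (a + 1 / 2) (a + 1) hc (by linarith) le_rfl) ht2
    rw [integral_affine] at hI1 hI2
    have hsplit := intervalIntegral.integral_add_adjacent_intervals (hint a (a + 1 / 2) le_rfl hc (by linarith))
      (hint (a + 1 / 2) (a + 1) hc (by linarith) le_rfl)
    rw [← hsplit]
    nlinarith [hI1, hI2]

/-- ★ **`TrapezoidConvex` holds.** [folklore] -/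
theorem trapezoidConvex_holds : TrapezoidConvex := by
  intro f f' A B hAB hfc hd _hcont
  -- the number of unit intervals
  obtain ⟨n, hn⟩ : ∃ n : ℕ, (B : ℤ) = A + (n : ℤ) + 1 := ⟨(B - A - 1).toNat, by omega⟩
  have hBR : (B : ℝ) = (A : ℝ) + (n : ℝ) + 1 := by exact_mod_cast hn
  -- unit sub-intervals
  have hsubI : ∀ j : ℕ, j < n + 1 → Set.Icc ((A : ℝ) + j) ((A : ℝ) + j + 1) ⊆ Set.Icc (A : ℝ) (B : ℝ) := by
    intro j hj
    have hj' : (j : ℝ) ≤ n := by exact_mod_cast Nat.lt_succ_iff.mp hj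
    exact Set.Icc_subset_Icc (by have := Nat.cast_nonneg (α := ℝ) j; linarith) (by rw [hBR]; linarith)
  have hunit : ∀ j : ℕ, j < n + 1 →
      0 ≤ (f ((A : ℝ) + j) + f ((A : ℝ) + j + 1)) / 2 - ∫ x in ((A : ℝ) + j)..((A : ℝ) + j + 1), f x ∧
        (f ((A : ℝ) + j) + f ((A : ℝ) + j + 1)) / 2 - ∫ x in ((A : ℝ) + j)..((A : ℝ) + j + 1), f x
          ≤ (f' ((A : ℝ) + j + 1) - f' ((A : ℝ) + j)) / 8 :=
    fun j hj => trapezoid_unit hfc (hsubI j hj) (fun x hx => hd x (hsubI j hj hx))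
  -- the integral as a sum over unit intervals
  have hcont : ContinuousOn f (Set.Icc (A : ℝ) B) := fun x hx => (hd x hx).continuousAt.continuousWithinAt
  have hI : ∫ x in (A : ℝ)..(B : ℝ), f x
      = ∑ j ∈ Finset.range (n + 1), ∫ x in ((A : ℝ) + j)..((A : ℝ) + j + 1), f x := by
    have h := intervalIntegral.sum_integral_adjacent_intervals (a := fun k : ℕ => (A : ℝ) + k) (n := n + 1)
      (μ := volume) (f := f) (by
        intro k hk
        refine ContinuousOn.intervalIntegrable ?_
        have hk1 : ((A : ℝ) + k) ≤ (A : ℝ) + ((k + 1 : ℕ) : ℝ) := by push_cast; linarith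
        rw [Set.uIcc_of_le hk1]
        refine hcont.mono ?_
        have := hsubI k hk
        push_cast at this ⊢
        rw [← add_assoc]
        exact this)
    simp only [Nat.cast_zero, add_zero] at h
    rw [show (A : ℝ) + ((n + 1 : ℕ) : ℝ) = (B : ℝ) by rw [hBR]; push_cast; ring] at h
    rw [← h]
    refine Finset.sum_congr rfl fun j _ => ?_
    push_cast; ring_nf
  -- the sum over `Finset.Icc A B` as a range sum
  have hS : ∑ m ∈ Finset.Icc A B, f m = ∑ j ∈ Finset.range (n + 2), f ((A : ℝ) + j) := by
    rw [Int.Icc_eq_finset_map, Finset.sum_map]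
    have : (B + 1 - A).toNat = n + 2 := by omega
    rw [this]
    refine Finset.sum_congr rfl fun j _ => ?_
    simp
  -- trapezoid sum identity
  have hT : ∑ j ∈ Finset.range (n + 2), f ((A : ℝ) + j) - (f A + f B) / 2
      = ∑ j ∈ Finset.range (n + 1), (f ((A : ℝ) + j) + f ((A : ℝ) + j + 1)) / 2 := by
    have e1 : ∑ j ∈ Finset.range (n + 1), (f ((A : ℝ) + j) + f ((A : ℝ) + j + 1)) / 2
        = (∑ j ∈ Finset.range (n + 1), f ((A : ℝ) + j) + ∑ j ∈ Finset.range (n + 1), f ((A : ℝ) + j + 1)) / 2 := by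
      rw [← Finset.sum_add_distrib, Finset.sum_div]
    have e2 : ∑ j ∈ Finset.range (n + 2), f ((A : ℝ) + j) = ∑ j ∈ Finset.range (n + 1), f ((A : ℝ) + j) + f B := by
      rw [Finset.sum_range_succ, hBR]; push_cast; ring_nf
    have e3 : ∑ j ∈ Finset.range (n + 2), f ((A : ℝ) + j) = f A + ∑ j ∈ Finset.range (n + 1), f ((A : ℝ) + j + 1) := by
      rw [Finset.sum_range_succ']
      simp only [Nat.cast_zero, add_zero, Nat.cast_succ]
      rw [add_comm]
      congr 1
      refine Finset.sum_congr rfl fun j _ => ?_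
      congr 1
      ring
    rw [e1]
    linarith [e2, e3]
  -- telescoping of the derivative differences
  have htel : ∑ j ∈ Finset.range (n + 1), (f' ((A : ℝ) + j + 1) - f' ((A : ℝ) + j)) / 8 = (f' B - f' A) / 8 := by
    rw [← Finset.sum_div]
    congr 1
    have h := Finset.sum_range_sub (fun j : ℕ => f' ((A : ℝ) + j)) (n + 1)
    simp only [Nat.cast_zero, add_zero] at h
    rw [show (A : ℝ) + ((n + 1 : ℕ) : ℝ) = (B : ℝ) by rw [hBR]; push_cast; ring] at h
    rw [← h]
    refine Finset.sum_congr rfl fun j _ => ?_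
    push_cast; ring_nf
  -- assemble
  have key : (∑ m ∈ Finset.Icc A B, f m) - (∫ x in (A : ℝ)..B, f x) - (f A + f B) / 2
      = ∑ j ∈ Finset.range (n + 1),
          ((f ((A : ℝ) + j) + f ((A : ℝ) + j + 1)) / 2 - ∫ x in ((A : ℝ) + j)..((A : ℝ) + j + 1), f x) := by
    rw [hS, hI, Finset.sum_sub_distrib, ← hT]; ring
  rw [key]
  constructor
  · exact Finset.sum_nonneg fun j hj => (hunit j (Finset.mem_range.1 hj)).1
  · rw [← htel]
    exact Finset.sum_le_sum fun j hj => (hunit j (Finset.mem_range.1 hj)).2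

end Summit.HubbardSuperconductivity.HubbardSuperconductivity.Theorems.AnisotropyChord.Transfer.Fibre3

end
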